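import Literature.RingTheory.FormalGroups.LazardRing
import Mathlib.Data.Nat.Choose.Sum
import Mathlib.Algebra.Ring.GeomSum
import HarnessLib

/-!
# First-order deformations of the additive law: the associator of `X + Y + Σ εₐ XᵃYᵐ⁻ᵃ` with `εₐε_b = 0`
# ([Lazard1955] §II–III, «bourgeons»; [Frohlich1968] Ch. III §1)

Topic `Literature/RingTheory/FormalGroups`; namespace `Literature.RingTheory.FormalGroups`.  Two plumbing definitions
(`pertSum`, `pertAdd`) and fully proved theorems; no named fact, no instance, no notation, no `sorry`.

Over a commutative ring `A`, let `ε : ℕ → A` have pairwise vanishing products (`εₐ ε_b = 0`, e.g. the coordinates of a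
square-zero extension `ℤ ⊕ M`) and let `m ≥ 2`.  The two-variable series
`F_ε(X,Y) = X + Y + Γ_ε(X,Y)`, `Γ_ε(U,V) = Σ_{0<a<m} εₐ Uᵃ V^{m−a}` (`pertAdd ε m`, `pertSum ε m U V`) is the general
first-order deformation of the additive law in degree `m`, and Lazard's computation of its associator
(`assocDiff`, file `LazardRing`) is
`F_ε(F_ε(X,Y),Z) − F_ε(X,F_ε(Y,Z)) = Γ_ε(X,Y) + Γ_ε(X+Y,Z) − Γ_ε(Y,Z) − Γ_ε(X,Y+Z)` (`assocDiff_pertAdd`), whose coefficient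
of `XⁱYʲZᵏ` (`i,j,k ≥ 1`, `i+j+k = m`) is `C(i+j,i) ε_{i+j} − C(j+k,j) εᵢ` (`coeff_assocDiff_pertAdd`): `F_ε` is associative iff
`ε` is a **2-cocycle**, and commutative iff `ε` is symmetric (`coeff_swap_sub_pertAdd`).  This is the computation behind
the linearisation of the Lazard ring (`LazardRingGenerators`) and behind the leading term of the universal
strict-isomorphism law (`LazardRingPolynomial`).

## References
* [Lazard1955] M. Lazard, *Sur les groupes de Lie formels à un paramètre*, Bull. SMF 83 (1955), §II–III.
* [Frohlich1968] A. Fröhlich, *Formal Groups*, LNM 74 (1968), Ch. III §1.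
-/

noncomputable section

namespace Literature.RingTheory.FormalGroups

open _root_.MvPowerSeries (HasSubst subst coeff)
open Finset

universe u

variable {A : Type u} [CommRing A]

/-! ## §1 The perturbation sum and the perturbed additive law -/

/-- The perturbation `Γ_ε(U,V) = Σ_{0<a<m} εₐ Uᵃ V^{m−a}` (a polynomial expression in two series `U`, `V`).
[cite: Lazard1955, §II] -/
def pertSum (ε : ℕ → A) (m : ℕ) {σ : Type*} (U V : MvPowerSeries σ A) : MvPowerSeries σ A :=
  ∑ a ∈ Ioo 0 m, MvPowerSeries.C (ε a) * U ^ a * V ^ (m - a)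

/-- The perturbed additive law `F_ε(X,Y) = X + Y + Γ_ε(X,Y)` in degree `m`. [cite: Lazard1955, §II] -/
def pertAdd (ε : ℕ → A) (m : ℕ) : MvPowerSeries (Fin 2) A :=
  MvPowerSeries.X 0 + MvPowerSeries.X 1 + pertSum ε m (MvPowerSeries.X 0) (MvPowerSeries.X 1)

variable (ε : ℕ → A) (m : ℕ)

/-- `εₐ · Γ_ε(U,V) = 0` when the `ε`'s have vanishing pairwise products. [cite: Lazard1955, §II] -/
theorem C_mul_pertSum_eq_zero (hε : ∀ a b, ε a * ε b = 0) {σ : Type*} (U V : MvPowerSeries σ A) (a : ℕ) :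
    MvPowerSeries.C (ε a) * pertSum ε m U V = 0 := by
  rw [pertSum, mul_sum]
  refine sum_eq_zero fun b _ => ?_
  rw [← mul_assoc, ← mul_assoc, ← map_mul, hε, map_zero, zero_mul, zero_mul]

/-- `c (S + E)^q = c S^q` when `c E = 0` (binomial expansion with a square-zero perturbation). [folklore] -/
private theorem mul_add_pow_of_mul_eq_zero {B : Type*} [CommRing B] (c S E : B) (h : c * E = 0) (q : ℕ) :
    c * (S + E) ^ q = c * S ^ q := by
  obtain ⟨W, hW⟩ := sub_dvd_pow_sub_pow (S + E) S q
  rw [add_sub_cancel_left] at hW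
  have : (S + E) ^ q = S ^ q + E * W := by rw [← hW]; ring
  rw [this, mul_add, ← mul_assoc, h, zero_mul, add_zero]

/-- **Square-zero insensitivity, left**: `Γ_ε(S + E, V) = Γ_ε(S, V)` whenever `εₐ E = 0` for all `a`. [cite: Lazard1955, §II] -/
theorem pertSum_add_left {σ : Type*} (S E V : MvPowerSeries σ A) (hE : ∀ a, MvPowerSeries.C (ε a) * E = 0) :
    pertSum ε m (S + E) V = pertSum ε m S V := by
  unfold pertSum
  refine sum_congr rfl fun a _ => ?_
  rw [mul_add_pow_of_mul_eq_zero _ _ _ (hE a)]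

/-- **Square-zero insensitivity, right**: `Γ_ε(U, S + E) = Γ_ε(U, S)` whenever `εₐ E = 0` for all `a`. [cite: Lazard1955, §II] -/
theorem pertSum_add_right {σ : Type*} (U S E : MvPowerSeries σ A) (hE : ∀ a, MvPowerSeries.C (ε a) * E = 0) :
    pertSum ε m U (S + E) = pertSum ε m U S := by
  unfold pertSum
  refine sum_congr rfl fun a _ => ?_
  rw [mul_right_comm, mul_add_pow_of_mul_eq_zero _ _ _ (hE a), mul_right_comm]

/-- Substituting into the perturbation: `Γ_ε(U,V)(f) = Γ_ε(U(f), V(f))`. [cite: Lazard1955, §II] -/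
theorem subst_pertSum {σ τ : Type*} {f : σ → MvPowerSeries τ A} (hf : HasSubst f) (U V : MvPowerSeries σ A) :
    (pertSum ε m U V).subst f = pertSum ε m (U.subst f) (V.subst f) := by
  unfold pertSum
  rw [← MvPowerSeries.coe_substAlgHom hf, map_sum]
  refine sum_congr rfl fun a _ => ?_
  rw [map_mul, map_mul, map_pow, map_pow, MvPowerSeries.coe_substAlgHom hf, MvPowerSeries.subst_C]

/-- **Substituting into the perturbed law**: `F_ε(U,V) = U + V + Γ_ε(U,V)`. [cite: Lazard1955, §II] -/
theorem subst_pertAdd {τ : Type*} {U V : MvPowerSeries τ A} (h : HasSubst ![U, V]) :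
    (pertAdd ε m).subst ![U, V] = U + V + pertSum ε m U V := by
  rw [pertAdd, MvPowerSeries.subst_add h, MvPowerSeries.subst_add h, MvPowerSeries.subst_X h,
    MvPowerSeries.subst_X h, subst_pertSum ε m h, MvPowerSeries.subst_X h, MvPowerSeries.subst_X h]
  rfl

/-- The perturbation has no constant term and no linear term: its constant coefficient vanishes (`m ≥ 2` is not even
needed: every summand has total degree `m ≥ 1`... we only record `Γ_ε(U,V)(0) = 0` for `U(0) = V(0) = 0`, `m ≥ 1`).
[cite: Lazard1955, §II] -/
theorem constantCoeff_pertSum {σ : Type*} (U V : MvPowerSeries σ A) (hU : U.constantCoeff = 0) (hm : 0 < m) :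
    (pertSum ε m U V).constantCoeff = 0 := by
  unfold pertSum
  rw [map_sum]
  refine sum_eq_zero fun a ha => ?_
  have ha0 : 0 < a := (mem_Ioo.mp ha).1
  have _ := hm
  rw [map_mul, map_mul, map_pow, hU, zero_pow ha0.ne', mul_zero, zero_mul]

/-- `F_ε(0,0) = 0`. [cite: Lazard1955, §II] -/
theorem constantCoeff_pertAdd (hm : 0 < m) : (pertAdd ε m).constantCoeff = 0 := by
  rw [pertAdd, map_add, map_add, MvPowerSeries.constantCoeff_X, MvPowerSeries.constantCoeff_X,
    constantCoeff_pertSum ε m _ _ (MvPowerSeries.constantCoeff_X 0) hm, add_zero, add_zero]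

/-! ## §2 The associator of the perturbed additive law -/

/-- **Lazard's associator formula**: for `εₐ ε_b = 0`,
`F_ε(F_ε(X,Y),Z) − F_ε(X,F_ε(Y,Z)) = Γ_ε(X,Y) + Γ_ε(X+Y,Z) − Γ_ε(Y,Z) − Γ_ε(X,Y+Z)`. [cite: Lazard1955, §II Lemme 3] -/
theorem assocDiff_pertAdd (hε : ∀ a b, ε a * ε b = 0) (hm : 0 < m) :
    assocDiff (pertAdd ε m) =
      pertSum ε m (MvPowerSeries.X 0 : MvPowerSeries (Fin 3) A) (MvPowerSeries.X 1) +
        pertSum ε m (MvPowerSeries.X 0 + MvPowerSeries.X 1 : MvPowerSeries (Fin 3) A) (MvPowerSeries.X 2) -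
      pertSum ε m (MvPowerSeries.X 1 : MvPowerSeries (Fin 3) A) (MvPowerSeries.X 2) -
        pertSum ε m (MvPowerSeries.X 0 : MvPowerSeries (Fin 3) A) (MvPowerSeries.X 1 + MvPowerSeries.X 2) := by
  have h0 := constantCoeff_pertAdd ε m hm
  have hL : HasSubst ![(pertAdd ε m).subst ![MvPowerSeries.X 0, MvPowerSeries.X 1], (MvPowerSeries.X 2 :
      MvPowerSeries (Fin 3) A)] := HasSubst.cons_subst_zero_left (0 : Fin 3) 1 2 h0
  have hR : HasSubst ![(MvPowerSeries.X 0 : MvPowerSeries (Fin 3) A),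
      (pertAdd ε m).subst ![MvPowerSeries.X 1, MvPowerSeries.X 2]] := HasSubst.cons_subst_zero_right (0 : Fin 3) 1 2 h0
  rw [assocDiff, subst_pertAdd ε m hL, subst_pertAdd ε m hR, subst_pertAdd ε m HasSubst.X_X,
    subst_pertAdd ε m HasSubst.X_X, pertSum_add_left ε m _ _ _ (C_mul_pertSum_eq_zero ε m hε _ _),
    pertSum_add_right ε m _ _ _ (C_mul_pertSum_eq_zero ε m hε _ _)]
  ring

/-! ## §3 Coefficients -/

/-- The exponent `(i, j, k)` of `XⁱYʲZᵏ`. [folklore] -/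
private def e3 (i j k : ℕ) : Fin 3 →₀ ℕ := Finsupp.single 0 i + Finsupp.single 1 j + Finsupp.single 2 k

/-- Component `0` of `e3` (plumbing). [folklore] -/
@[simp] private theorem e3_zero (i j k : ℕ) : e3 i j k 0 = i := by simp [e3]
/-- Component `1` of `e3` (plumbing). [folklore] -/
@[simp] private theorem e3_one (i j k : ℕ) : e3 i j k 1 = j := by simp [e3]
/-- Component `2` of `e3` (plumbing). [folklore] -/
@[simp] private theorem e3_two (i j k : ℕ) : e3 i j k 2 = k := by simp [e3]

/-- `e3` is injective (plumbing). [folklore] -/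
private theorem e3_inj {i j k i' j' k' : ℕ} : e3 i j k = e3 i' j' k' ↔ i = i' ∧ j = j' ∧ k = k' := by
  constructor
  · intro h
    exact ⟨by simpa using congrArg (fun e => e 0) h, by simpa using congrArg (fun e => e 1) h,
      by simpa using congrArg (fun e => e 2) h⟩
  · rintro ⟨rfl, rfl, rfl⟩; rfl

/-- Every `Fin 3`-exponent is an `e3`. [folklore] -/
private theorem e3_eta (n : Fin 3 →₀ ℕ) : n = e3 (n 0) (n 1) (n 2) := by
  ext s; fin_cases s <;> simp

/-- The monomial `c · X_p^a X_q^b X_r^c'` for `{p,q,r} = {0,1,2}` in the order `(0,1,2)`: its coefficients. [folklore] -/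
private theorem coeff_C_mul_X_pow_mul (c : A) (a b c' : ℕ) (n : Fin 3 →₀ ℕ) :
    coeff n (MvPowerSeries.C c * (MvPowerSeries.X 0 ^ a * MvPowerSeries.X 1 ^ b * MvPowerSeries.X 2 ^ c' :
      MvPowerSeries (Fin 3) A)) = if n = e3 a b c' then c else 0 := by
  classical
  rw [MvPowerSeries.X_pow_eq, MvPowerSeries.X_pow_eq, MvPowerSeries.X_pow_eq, MvPowerSeries.monomial_mul_monomial,
    MvPowerSeries.monomial_mul_monomial, MvPowerSeries.coeff_C_mul, MvPowerSeries.coeff_monomial]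
  simp [e3]

/-- Coefficients of `Γ_ε(X₀ + X₁, X₂)` at a mixed exponent `(i,j,k)`, `k ≥ 1`... precisely, for `i + j + k = m` and
`0 < i + j < m`: the coefficient is `C(i+j, i) ε_{i+j}`. [cite: Lazard1955, §II Lemme 3] -/
theorem coeff_pertSum_add_X (i j k : ℕ) (hij : 0 < i + j) (hk : 0 < k) (hm : i + j + k = m) :
    coeff (Finsupp.single 0 i + Finsupp.single 1 j + Finsupp.single 2 k)
      (pertSum ε m (MvPowerSeries.X 0 + MvPowerSeries.X 1 : MvPowerSeries (Fin 3) A) (MvPowerSeries.X 2)) =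
      ((i + j).choose i : ℕ) * ε (i + j) := by
  classical
  change coeff (e3 i j k) _ = _
  unfold pertSum
  simp_rw [add_pow, mul_sum, sum_mul, map_sum]
  rw [sum_eq_single_of_mem (i + j) (mem_Ioo.mpr ⟨hij, by omega⟩)]
  · rw [sum_eq_single_of_mem i (mem_range.mpr (by omega))]
    · have : MvPowerSeries.C (ε (i + j)) * (MvPowerSeries.X 0 ^ i * MvPowerSeries.X 1 ^ (i + j - i) *
          ((i + j).choose i : MvPowerSeries (Fin 3) A)) * MvPowerSeries.X 2 ^ (m - (i + j)) =
          MvPowerSeries.C (((i + j).choose i : ℕ) * ε (i + j)) *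
            (MvPowerSeries.X 0 ^ i * MvPowerSeries.X 1 ^ j * MvPowerSeries.X 2 ^ k) := by
        rw [show i + j - i = j by omega, show m - (i + j) = k by omega, map_mul, map_natCast]; ring
      rw [this, coeff_C_mul_X_pow_mul, if_pos rfl]
    · intro l _ hl
      have : MvPowerSeries.C (ε (i + j)) * (MvPowerSeries.X 0 ^ l * MvPowerSeries.X 1 ^ (i + j - l) *
          ((i + j).choose l : MvPowerSeries (Fin 3) A)) * MvPowerSeries.X 2 ^ (m - (i + j)) =
          MvPowerSeries.C (((i + j).choose l : ℕ) * ε (i + j)) *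
            (MvPowerSeries.X 0 ^ l * MvPowerSeries.X 1 ^ (i + j - l) * MvPowerSeries.X 2 ^ (m - (i + j))) := by
        rw [map_mul, map_natCast]; ring
      rw [this, coeff_C_mul_X_pow_mul, if_neg]
      rw [e3_inj]; omega
  · intro a _ ha
    refine sum_eq_zero fun l _ => ?_
    have : MvPowerSeries.C (ε a) * (MvPowerSeries.X 0 ^ l * MvPowerSeries.X 1 ^ (a - l) *
        (a.choose l : MvPowerSeries (Fin 3) A)) * MvPowerSeries.X 2 ^ (m - a) =
        MvPowerSeries.C ((a.choose l : ℕ) * ε a) *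
          (MvPowerSeries.X 0 ^ l * MvPowerSeries.X 1 ^ (a - l) * MvPowerSeries.X 2 ^ (m - a)) := by
      rw [map_mul, map_natCast]; ring
    rw [this, coeff_C_mul_X_pow_mul, if_neg]
    rw [e3_inj]; omega

/-- Coefficients of `Γ_ε(X₀, X₁ + X₂)` at `(i,j,k)` with `0 < i`, `i + j + k = m`, `j + k > 0`... : `C(j+k, j) εᵢ`.
[cite: Lazard1955, §II Lemme 3] -/
theorem coeff_pertSum_X_add (i j k : ℕ) (hi : 0 < i) (hjk : 0 < j + k) (hm : i + j + k = m) :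
    coeff (Finsupp.single 0 i + Finsupp.single 1 j + Finsupp.single 2 k)
      (pertSum ε m (MvPowerSeries.X 0 : MvPowerSeries (Fin 3) A) (MvPowerSeries.X 1 + MvPowerSeries.X 2)) =
      ((j + k).choose j : ℕ) * ε i := by
  classical
  change coeff (e3 i j k) _ = _
  unfold pertSum
  simp_rw [add_pow, mul_sum, map_sum]
  rw [sum_eq_single_of_mem i (mem_Ioo.mpr ⟨hi, by omega⟩)]
  · rw [show m - i = j + k by omega, sum_eq_single_of_mem j (mem_range.mpr (by omega))]
    · have : MvPowerSeries.C (ε i) * MvPowerSeries.X 0 ^ i * (MvPowerSeries.X 1 ^ j * MvPowerSeries.X 2 ^ (j + k - j) *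
          ((j + k).choose j : MvPowerSeries (Fin 3) A)) =
          MvPowerSeries.C (((j + k).choose j : ℕ) * ε i) *
            (MvPowerSeries.X 0 ^ i * MvPowerSeries.X 1 ^ j * MvPowerSeries.X 2 ^ k) := by
        rw [show j + k - j = k by omega, map_mul, map_natCast]; ring
      rw [this, coeff_C_mul_X_pow_mul, if_pos rfl]
    · intro l _ hl
      have : MvPowerSeries.C (ε i) * MvPowerSeries.X 0 ^ i * (MvPowerSeries.X 1 ^ l * MvPowerSeries.X 2 ^ (j + k - l) *
          ((j + k).choose l : MvPowerSeries (Fin 3) A)) =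
          MvPowerSeries.C (((j + k).choose l : ℕ) * ε i) *
            (MvPowerSeries.X 0 ^ i * MvPowerSeries.X 1 ^ l * MvPowerSeries.X 2 ^ (j + k - l)) := by
        rw [map_mul, map_natCast]; ring
      rw [this, coeff_C_mul_X_pow_mul, if_neg]
      rw [e3_inj]; omega
  · intro a _ ha
    refine sum_eq_zero fun l _ => ?_
    have : MvPowerSeries.C (ε a) * MvPowerSeries.X 0 ^ a * (MvPowerSeries.X 1 ^ l * MvPowerSeries.X 2 ^ (m - a - l) *
        ((m - a).choose l : MvPowerSeries (Fin 3) A)) =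
        MvPowerSeries.C (((m - a).choose l : ℕ) * ε a) *
          (MvPowerSeries.X 0 ^ a * MvPowerSeries.X 1 ^ l * MvPowerSeries.X 2 ^ (m - a - l)) := by
      rw [map_mul, map_natCast]; ring
    rw [this, coeff_C_mul_X_pow_mul, if_neg]
    rw [e3_inj]; omega

/-- `Γ_ε(X₀, X₁)` has no monomial involving `X₂`. [cite: Lazard1955, §II Lemme 3] -/
theorem coeff_pertSum_X_X_01 (n : Fin 3 →₀ ℕ) (hn : n 2 ≠ 0) :
    coeff n (pertSum ε m (MvPowerSeries.X 0 : MvPowerSeries (Fin 3) A) (MvPowerSeries.X 1)) = 0 := by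
  classical
  unfold pertSum
  rw [map_sum]
  refine sum_eq_zero fun a _ => ?_
  have : MvPowerSeries.C (ε a) * MvPowerSeries.X 0 ^ a * MvPowerSeries.X 1 ^ (m - a) =
      MvPowerSeries.C (ε a) * (MvPowerSeries.X 0 ^ a * MvPowerSeries.X 1 ^ (m - a) * MvPowerSeries.X 2 ^ 0 :
        MvPowerSeries (Fin 3) A) := by rw [pow_zero, mul_one, mul_assoc]
  rw [this, coeff_C_mul_X_pow_mul, if_neg]
  intro h; apply hn; rw [h]; simp

/-- `Γ_ε(X₁, X₂)` has no monomial involving `X₀`. [cite: Lazard1955, §II Lemme 3] -/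
theorem coeff_pertSum_X_X_12 (n : Fin 3 →₀ ℕ) (hn : n 0 ≠ 0) :
    coeff n (pertSum ε m (MvPowerSeries.X 1 : MvPowerSeries (Fin 3) A) (MvPowerSeries.X 2)) = 0 := by
  classical
  unfold pertSum
  rw [map_sum]
  refine sum_eq_zero fun a _ => ?_
  have : MvPowerSeries.C (ε a) * MvPowerSeries.X 1 ^ a * MvPowerSeries.X 2 ^ (m - a) =
      MvPowerSeries.C (ε a) * (MvPowerSeries.X 0 ^ 0 * MvPowerSeries.X 1 ^ a * MvPowerSeries.X 2 ^ (m - a) :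
        MvPowerSeries (Fin 3) A) := by rw [pow_zero, one_mul, mul_assoc]
  rw [this, coeff_C_mul_X_pow_mul, if_neg]
  intro h; apply hn; rw [h]; simp

/-- **The 2-cocycle identity, coefficientwise**: for `εₐ ε_b = 0`, `i, j, k ≥ 1`, `i + j + k = m`, the coefficient of
`XⁱYʲZᵏ` in the associator of `F_ε` is `C(i+j,i) ε_{i+j} − C(j+k,j) εᵢ`.  Hence `F_ε` is associative iff
`C(i+j,i) ε_{i+j} = C(j+k,j) εᵢ` for all such `i, j, k`. [cite: Lazard1955, §II Lemme 3] -/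
theorem coeff_assocDiff_pertAdd (hε : ∀ a b, ε a * ε b = 0) (i j k : ℕ) (hi : 0 < i) (hj : 0 < j) (hk : 0 < k)
    (hm : i + j + k = m) :
    coeff (Finsupp.single 0 i + Finsupp.single 1 j + Finsupp.single 2 k) (assocDiff (pertAdd ε m)) =
      ((i + j).choose i : ℕ) * ε (i + j) - ((j + k).choose j : ℕ) * ε i := by
  rw [assocDiff_pertAdd ε m hε (by omega), map_sub, map_sub, map_add,
    coeff_pertSum_add_X ε m i j k (by omega) hk hm, coeff_pertSum_X_add ε m i j k hi (by omega) hm,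
    coeff_pertSum_X_X_01 ε m _ (by simpa using hk.ne'), coeff_pertSum_X_X_12 ε m _ (by simpa using hi.ne')]
  ring

/-! ## §4 Coefficients of the perturbed law and the symmetry defect -/

/-- The exponent `(i, j)` of `XⁱYʲ`. [folklore] -/
private def e2 (i j : ℕ) : Fin 2 →₀ ℕ := Finsupp.single 0 i + Finsupp.single 1 j

/-- Component `0` of `e2` (plumbing). [folklore] -/
@[simp] private theorem e2_zero (i j : ℕ) : e2 i j 0 = i := by simp [e2]
/-- Component `1` of `e2` (plumbing). [folklore] -/
@[simp] private theorem e2_one (i j : ℕ) : e2 i j 1 = j := by simp [e2]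

/-- `e2` is injective (plumbing). [folklore] -/
private theorem e2_inj {i j i' j' : ℕ} : e2 i j = e2 i' j' ↔ i = i' ∧ j = j' := by
  constructor
  · intro h
    exact ⟨by simpa using congrArg (fun e => e 0) h, by simpa using congrArg (fun e => e 1) h⟩
  · rintro ⟨rfl, rfl⟩; rfl

/-- Every `Fin 2`-exponent is an `e2` (plumbing). [folklore] -/
private theorem e2_eta (d : Fin 2 →₀ ℕ) : d = e2 (d 0) (d 1) := by
  ext s; fin_cases s <;> simp

/-- Coefficients of `c · X₀ᵃ X₁ᵇ`. [folklore] -/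
private theorem coeff_C_mul_X_pow_mul₂ (c : A) (a b : ℕ) (d : Fin 2 →₀ ℕ) :
    coeff d (MvPowerSeries.C c * (MvPowerSeries.X 0 ^ a * MvPowerSeries.X 1 ^ b : MvPowerSeries (Fin 2) A)) =
      if d = e2 a b then c else 0 := by
  classical
  rw [MvPowerSeries.X_pow_eq, MvPowerSeries.X_pow_eq, MvPowerSeries.monomial_mul_monomial, MvPowerSeries.coeff_C_mul,
    MvPowerSeries.coeff_monomial]
  simp [e2]

/-- `swapIdx` exchanges the components of `e2` (plumbing). [folklore] -/
private theorem swapIdx_e2 (i j : ℕ) : swapIdx (e2 i j) = e2 j i := by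
  ext s; fin_cases s <;> simp

/-- **Coefficients of `Γ_ε(X,Y)`**: `εₐ` at `(a, m−a)` for `0 < a < m`, zero elsewhere. [cite: Lazard1955, §II] -/
theorem coeff_pertSum_X_X (d : Fin 2 →₀ ℕ) :
    coeff d (pertSum ε m (MvPowerSeries.X 0 : MvPowerSeries (Fin 2) A) (MvPowerSeries.X 1)) =
      if 0 < d 0 ∧ 0 < d 1 ∧ d 0 + d 1 = m then ε (d 0) else 0 := by
  classical
  obtain ⟨i, j, rfl⟩ : ∃ i j, d = e2 i j := ⟨d 0, d 1, e2_eta d⟩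
  simp only [e2_zero, e2_one]
  unfold pertSum
  rw [map_sum]
  simp_rw [mul_assoc, coeff_C_mul_X_pow_mul₂]
  by_cases h : 0 < i ∧ 0 < j ∧ i + j = m
  · rw [if_pos h, sum_eq_single_of_mem i (mem_Ioo.mpr ⟨h.1, by omega⟩)]
    · rw [if_pos]; rw [e2_inj]; omega
    · intro a _ ha; rw [if_neg]; rw [e2_inj]; omega
  · rw [if_neg h]
    refine sum_eq_zero fun a ha => ?_
    rw [mem_Ioo] at ha
    rw [if_neg]; rw [e2_inj]; omega

/-- **Coefficients of the perturbed law `F_ε`** (`m ≥ 2`): `εₐ` at interior `(a, m−a)`, `0` at the other interior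
exponents; `1` at `(1,0)`, `(0,1)` and `0` at the remaining non-interior exponents. [cite: Lazard1955, §II] -/
theorem coeff_pertAdd (hm : 2 ≤ m) (d : Fin 2 →₀ ℕ) :
    coeff d (pertAdd ε m) =
      if 0 < d 0 ∧ 0 < d 1 then (if d 0 + d 1 = m then ε (d 0) else 0)
      else if d = Finsupp.single 0 1 ∨ d = Finsupp.single 1 1 then 1 else 0 := by
  classical
  rw [pertAdd, map_add, map_add, coeff_pertSum_X_X, MvPowerSeries.coeff_X, MvPowerSeries.coeff_X]
  have _ := hm
  by_cases h : 0 < d 0 ∧ 0 < d 1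
  · have h1 : ¬ d = Finsupp.single 0 1 := by rintro rfl; simp at h
    have h2 : ¬ d = Finsupp.single 1 1 := by rintro rfl; simp at h
    rw [if_neg h1, if_neg h2, zero_add, zero_add, if_pos h]
    by_cases h' : d 0 + d 1 = m
    · rw [if_pos ⟨h.1, h.2, h'⟩, if_pos h']
    · have h3 : ¬(0 < d 0 ∧ 0 < d 1 ∧ d 0 + d 1 = m) := fun hh => h' hh.2.2
      rw [if_neg h', if_neg h3]
  · have h3 : ¬(0 < d 0 ∧ 0 < d 1 ∧ d 0 + d 1 = m) := fun hh => h ⟨hh.1, hh.2.1⟩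
    rw [if_neg h3, add_zero, if_neg h]
    by_cases h1 : d = Finsupp.single 0 1
    · subst h1
      have h01 : ¬ (Finsupp.single (0 : Fin 2) 1 = Finsupp.single 1 1) := by
        simp [Finsupp.single_eq_single_iff]
      simp [h01]
    · by_cases h2 : d = Finsupp.single 1 1
      · subst h2; simp [h1]
      · simp [h1, h2]

/-- **The symmetry defect of `F_ε`**: the coefficient of `XⁱY^{m−i}` (`0 < i < m`) in `F_ε(Y,X) − F_ε(X,Y)` is
`ε_{m−i} − εᵢ`; so `F_ε` is commutative iff `ε` is symmetric. [cite: Lazard1955, §II] -/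
theorem coeff_swap_sub_pertAdd (hm : 2 ≤ m) (i : ℕ) (hi : 0 < i) (him : i < m) :
    coeff (Finsupp.single 0 i + Finsupp.single 1 (m - i))
      ((pertAdd ε m).subst ![(MvPowerSeries.X 1 : MvPowerSeries (Fin 2) A), MvPowerSeries.X 0] - pertAdd ε m) =
      ε (m - i) - ε i := by
  change coeff (e2 i (m - i)) _ = _
  rw [map_sub, coeff_subst_swap, swapIdx_e2, coeff_pertAdd ε m hm, coeff_pertAdd ε m hm]
  simp only [e2_zero, e2_one]
  rw [if_pos (by omega), if_pos (by omega), if_pos (by omega), if_pos (by omega)]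

end Literature.RingTheory.FormalGroups
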